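import Summits.QuantumFields.YangMills.Theorems.BalabanUVNodesN11K0DoorAtCRLetteredNumerics
import Summits.QuantumFields.YangMills.Theorems.BalabanUVNodesN11GaussianCertificateDefs

/-!
# DAG node N11 ∕ K0⁷ ∕ K1⁸ antecedent — K0⁷'s BODY `Provisos₁₃SepCoPH ∧ (ZhUnity ∧ SlotsNondegenerate₁₃) ∧ Admissible` (= `Record13SepCoPHInhabited`'s ∃-body for `F`, = K1⁸'s
# antecedent `Inhabited13 F`) WITNESSED AT A PARAMETER WITH `cR = c ∈ (0, 8]` — the history-blind door `θᴴ_c` over the cured cR-lettered member and its Gaussian certificate `θᴳ_c :=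
# gaussPinH θᴴ_c` — from dag-n24-c Part 14 §0c's K0-side inputs VERBATIM; the three slots `hP ∕ hU ∕ hθ` of the θ-GENERIC door theorem
# `N24_stabilityBR13SepCoPH_thetaShape20_rebindX_fourPin_pointed(_door)` supplied at the member BY NAME

HEADER — WORK-UNIT METADATA.  Cell `pub-ymgap`, YM-PLAN Track A (HUMAN RULING D-0062 ∕ D-0149 width seats), seat `pub-ymgap-dag-n11-w3` (g4; WIDTH SEAT 3∕4 on NODE n11 [B14]),
route `BalabanUVNodes` rev 27, deciding item K1⁸ `StabilityBRunRowsAtRecordR13SepCoPH` = stmt-QuantumFields-26907 (helper lane `--kind proof --supports 26907 --as helper`,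
count-neutral).  Sequel of this seat's p620936 `…N11K0DoorAtCRLetteredNumerics` (★★★★ the door `hP` at the member from Part 14's inputs) and p619867 `…N11SupplyChainAtCRLetteredNumerics`;
over dag-n11-w1's `…N11GaussianCertificateDefs` (`antecedent_gaussPinH`), node00-def-K0a's `slotsNondegenerate₁₃_theta13LiveOfNumerics_of_hasResiduals` ∕ `admissible_theta13OfNumerics`,
def-T's `Stage13RParams.ZrUnity.ofHistoryBlind`, K0a FILE 17 `finsum_ζ0_ZrOfRecord₁₃` (dag-n08-c g17's door convention, dag-n24-c `Node00/N24ItemsStage13AtDoorSepCoPH`), dag-n11-w6 X6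
`…N11K1WitnessGaussPinH` §1 (the same three slots at `θ₁₅ᶜᶜᴹᵂ` — the `c := 1` member).  [III] = [Balaban1988Convergent], [15] = [Balaban1985Variational], [I] = [Balaban1987RG1], [IV] = [Balaban1989LargeFieldI].

WHY THIS FILE.  After p619867 ∕ p620936 the cR-lettered member carries K0⁷'s door `hP` and N11's K0-rows road; what a K1 closer re-pointing its witness `θ₁₅ᶜᶜᴹᵂ ↦ θ_{c := 2}` still
needs BY NAME are the two other θ-slots of dag-n24-c's θ-generic door theorem — the unity ∧ non-degeneracy guard `hU` and admissibility `hθ` — at the member's door `θᴴ_c` and at its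
Gaussian certificate `θᴳ_c` (dag-n11-w6 X6's switch), and the statement that the member INHABITS K0⁷'s ∃-body ∕ K1⁸'s antecedent shape with `θ.s2.cR = c`.  All are one-liners over the
definers' generic lemmas; this file records them so that the member is a complete door-level witness candidate: `hP` (p620936) · `hU` · `hθ` · the ∃-body, at `θᴴ_c` and `θᴳ_c`.

WHAT THIS FILE PROVES (0 `def`, 0 `sorry`, standard axioms; `θ` = the member at K0b's residual pins, `hθ`).
§1 `slotsNondegenerate₁₃_ccmwCR` (hypothesis-free) · `admissible_ccmwCR` (window + signs + `0 < c`) · `zhUnity_slotsNondegenerate₁₃_door_ccmwCR` (the `hU` slot at `θᴴ_c`, UNCONDITIONAL) ·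
   `zhUnity_slotsNondegenerate₁₃_gaussPinH_door_ccmwCR` (the `hU` slot at `θᴳ_c`, UNCONDITIONAL) · `admissible_door_ccmwCR` ∕ `admissible_gaussPinH_door_ccmwCR` (the `hθ` slots) ·
   ★ `childrenReads_ccmwCR` (the CHILDREN slots `h06 h08 h10 h12 hUV` read the member exactly as `θ₁₅ᶜᶜᴹᵂ`: `toStage3Params`, `L`, `εbg`, `WOfRecord₁₃`, `densOfRecord₁₃`, `chiβOfRecord₁₃` — all `rfl`).
§2 ★★★ `k0Body_door_ccmwCR_of_gauge9TopStepR_of_betaBoxSignFree_allTorus` — `θᴴ_c.Provisos₁₃SepCoPH ∧ (θᴴ_c.ZhUnity ∧ θᴴ_c.SlotsNondegenerate₁₃) ∧ θᴴ_c.Admissible` from Part 14 §0c's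
   inputs VERBATIM + `0 < c ≤ 8` · ★★★ `antecedent_gaussPinH_door_ccmwCR_of_gauge9TopStepR_of_betaBoxSignFree_allTorus` — the same at `θᴳ_c` (dag-n11-w1 `antecedent_gaussPinH`) ·
   ★★★★ `exists_k0Body_cR_eq_of_gauge9TopStepR_of_betaBoxSignFree_allTorus` — K0⁷'s ∃-BODY FOR `F` (general `N`; at `N = 2` literally `Record13SepCoPHInhabited`'s body ∕ K1⁸'s
   `Inhabited13 F`) WITNESSED BY A PARAMETER WITH `θ.s2.cR = c`, any `c ∈ (0, 8]`, from Part 14 §0c's inputs.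

HONEST FRAMING ∕ A6.  Helper lane, count-neutral; one-line compositions BY NAME; (8), the (9)-step sentence and the sign-free windowed β-box are DISPLAYED HYPOTHESES (K0⁷'s stub
territory) — NOT proved here for any family; so this is K0⁷'s body CONDITIONALLY, exactly as dag-n21-c's ∕ dag-n24-c's bodies at `θ₁₅ᶜᶜᴹ(ᵂ)` are, now at a member where `2 ≤ cR` is
inhabitable.  NOT a re-pin of any witness (no `def`; `c := 1` member = `θ₁₅ᶜᶜᴹᵂ` by `rfl`); K0⁷ NOT closed; N11 NOT discharged; K1⁸ NOT closed, no stub touched; counts unmoved (typed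
28∕28 · discharged 5∕27 · A 5∕28).  One finite `𝕋⁴_{L^K}` programme at fixed `ε = L^{−K}`; `route-QuantumFields-BalabanUVNodes` closes ONLY the CONDITIONAL finite-𝕋⁴ rung
`BalabanLadder.UV` — NOT ℝ⁴, NOT OS, NOT the Yang–Mills mass gap (Clay).  No `sorry`, no `axiom`, no `def`, no `instance`, no `notation`.
Sources (SHAPE only): [III] Thm 1 p.262, (1.11) p.248, (2.6)–(2.8) pp.255–256, (2.10) p.256, (2.21) p.258, (3.16)–(3.23) pp.268–270; [15] (7) p.278, Thm 1 (8)–(9) p.279, (152) p.301,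
Prop. 8 p.304; [I] Thm 1 p.259, (0.20) p.256, (1.20)–(1.22) p.264; [IV] (0.2)–(0.4) p.176.
-/

noncomputable section

open MeasureTheory
open scoped Matrix.Norms.L2Operator

namespace Summit.QuantumFields.YangMills.Theorems.BalabanUVNodesN11K0BodyAtCRLetteredDoor

open Literature.MathematicalPhysics.QuantumFieldTheory.Balaban1983to89 Node00
open T4Continuum B14.Eq218Concrete B15DeterminingSets FlowStep FlowStepRuns B12RegularSpaces111 B14RegularSpaces234
open BalabanUVNodesN11GaussianCertificateDefs (gaussPinH gaussPinH_ζ0 antecedent_gaussPinH)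
open BalabanUVNodesN11K0DoorAtCRLetteredNumerics

variable {F : T4Family} {N : ℕ} [NeZero N] {j c₁₅ : ℕ} {γ c ε₀ ε₂₉ B₃ B₃' a₀ a₁ : ℝ} {θ : Stage13Params F N}

/-! ## §1  The `hU` and `hθ` slots at the member's door `θᴴ_c` and at `θᴳ_c := gaussPinH θᴴ_c` -/

section Slots

/-- **THE LIVE SELECTOR IS NON-DEGENERATE AT THE MEMBER** — hypothesis-free (node00-def-K0a's generic `slotsNondegenerate₁₃_theta13LiveOfNumerics_of_hasResiduals`).
[cite: Balaban1989LargeFieldI, (0.2)–(0.3) p.176; Balaban1988Convergent, (3.16)–(3.20) pp.268–269 (bookkeeping)] -/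
theorem slotsNondegenerate₁₃_ccmwCR (hθ : θ = theta13LiveOfNumerics F N
      ({ stage12NumericsOfThm1CCMW F.L j γ ε₀ B₃ B₃' a₀ a₁ with s2 := { sect2NumericsOfThm1C F.L with cR := c } } : Stage12Numerics) ε₂₉
      (zeta316OfRecord F N (stage12NumericsOfThm1CCMW F.L j γ ε₀ B₃ B₃' a₀ a₁).ν (stage12NumericsOfThm1CCMW F.L j γ ε₀ B₃ B₃' a₀ a₁).τ9.M
        (stage12NumericsOfThm1CCMW F.L j γ ε₀ B₃ B₃' a₀ a₁).A₁) (RzOfRecord F N) (ZtOfRecord F N)) : θ.SlotsNondegenerate₁₃ F N := by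
  subst hθ
  exact slotsNondegenerate₁₃_theta13LiveOfNumerics_of_hasResiduals F N _ ε₂₉

/-- **THE MEMBER IS ADMISSIBLE** from the window `0 < γ < 1`, `0 < c` and [15]'s signs (K0a `admissible_theta13OfNumerics` ∘ `.liveRepin₁₃` at the member's `Pos`).
[cite: Balaban1988Convergent, (2.4) p.255, (2.10) p.256; Balaban1987RG1, Thm 1 p.259; Balaban1989LargeFieldI, (0.4) p.176 (bookkeeping)] -/
theorem admissible_ccmwCR (hθ : θ = theta13LiveOfNumerics F N
      ({ stage12NumericsOfThm1CCMW F.L j γ ε₀ B₃ B₃' a₀ a₁ with s2 := { sect2NumericsOfThm1C F.L with cR := c } } : Stage12Numerics) ε₂₉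
      (zeta316OfRecord F N (stage12NumericsOfThm1CCMW F.L j γ ε₀ B₃ B₃' a₀ a₁).ν (stage12NumericsOfThm1CCMW F.L j γ ε₀ B₃ B₃' a₀ a₁).τ9.M
        (stage12NumericsOfThm1CCMW F.L j γ ε₀ B₃ B₃' a₀ a₁).A₁) (RzOfRecord F N) (ZtOfRecord F N)) (hc0 : 0 < c) (hγ0 : 0 < γ) (hγ1 : γ < 1) (hε : 0 < ε₀) (hε' : 0 < ε₂₉) (hB : 0 ≤ B₃) (hB' : 0 ≤ B₃')
    (ha₀ : 0 < a₀) (ha₁ : 0 < a₁) : θ.Admissible F N := by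
  subst hθ
  have hpos : ({ stage12NumericsOfThm1CCMW F.L j γ ε₀ B₃ B₃' a₀ a₁ with s2 := { sect2NumericsOfThm1C F.L with cR := c } } : Stage12Numerics).Pos := by
    obtain ⟨h1, h2, h3, h4, h5, h6, -, h8, h9⟩ := stage12NumericsOfThm1CCMW_pos (j := j) F.hL.2.le hγ0 hγ1 hε hB hB' ha₀ ha₁
    exact ⟨h1, h2, h3, h4, h5, h6, hc0, h8, h9⟩
  exact (admissible_theta13OfNumerics
    (n := ({ stage12NumericsOfThm1CCMW F.L j γ ε₀ B₃ B₃' a₀ a₁ with s2 := { sect2NumericsOfThm1C F.L with cR := c } } : Stage12Numerics)) F N _ _ _ hpos hε').liveRepin₁₃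

/-- **THE `hU` SLOT AT THE DOOR `θᴴ_c`** — unity by def-T's `ZrUnity.ofHistoryBlind` over K0a's `finsum_ζ0_ZrOfRecord₁₃`, non-degeneracy by §1 — UNCONDITIONAL (dag-n08-c g17's door
convention, as in dag-n24-c's `N24_…_pointed_door`). [cite: Balaban1988Convergent, (1.11) p.248, (3.16)–(3.22) pp.268–269; Balaban1989LargeFieldI, (0.2)–(0.3) p.176 (bookkeeping)] -/
theorem zhUnity_slotsNondegenerate₁₃_door_ccmwCR (hθ : θ = theta13LiveOfNumerics F N
      ({ stage12NumericsOfThm1CCMW F.L j γ ε₀ B₃ B₃' a₀ a₁ with s2 := { sect2NumericsOfThm1C F.L with cR := c } } : Stage12Numerics) ε₂₉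
      (zeta316OfRecord F N (stage12NumericsOfThm1CCMW F.L j γ ε₀ B₃ B₃' a₀ a₁).ν (stage12NumericsOfThm1CCMW F.L j γ ε₀ B₃ B₃' a₀ a₁).τ9.M
        (stage12NumericsOfThm1CCMW F.L j γ ε₀ B₃ B₃' a₀ a₁).A₁) (RzOfRecord F N) (ZtOfRecord F N)) :
    (Stage13HParams.ofHistoryBlind F N ⟨θ, ZrOfRecord₁₃ F N θ⟩).ZhUnity F N ∧ (Stage13HParams.ofHistoryBlind F N ⟨θ, ZrOfRecord₁₃ F N θ⟩).SlotsNondegenerate₁₃ F N :=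
  ⟨Stage13RParams.ZrUnity.ofHistoryBlind (θ := ⟨θ, ZrOfRecord₁₃ F N θ⟩) fun p j ω => finsum_ζ0_ZrOfRecord₁₃ (θ := θ) (p := p) j ω, slotsNondegenerate₁₃_ccmwCR hθ⟩

/-- **THE `hU` SLOT AT `θᴳ_c := gaussPinH θᴴ_c`** — unity UNCONDITIONAL at the certificate (dag-n11-w1 `zhUnity_of_gaussCert`), non-degeneracy by §1.
[cite: Balaban1988Convergent, (1.11) p.248, (3.16)–(3.22) pp.268–269; Balaban1989LargeFieldI, (0.2)–(0.3) p.176 (bookkeeping)] -/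
theorem zhUnity_slotsNondegenerate₁₃_gaussPinH_door_ccmwCR (hθ : θ = theta13LiveOfNumerics F N
      ({ stage12NumericsOfThm1CCMW F.L j γ ε₀ B₃ B₃' a₀ a₁ with s2 := { sect2NumericsOfThm1C F.L with cR := c } } : Stage12Numerics) ε₂₉
      (zeta316OfRecord F N (stage12NumericsOfThm1CCMW F.L j γ ε₀ B₃ B₃' a₀ a₁).ν (stage12NumericsOfThm1CCMW F.L j γ ε₀ B₃ B₃' a₀ a₁).τ9.M
        (stage12NumericsOfThm1CCMW F.L j γ ε₀ B₃ B₃' a₀ a₁).A₁) (RzOfRecord F N) (ZtOfRecord F N)) :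
    (gaussPinH (Stage13HParams.ofHistoryBlind F N ⟨θ, ZrOfRecord₁₃ F N θ⟩)).ZhUnity F N ∧ (gaussPinH (Stage13HParams.ofHistoryBlind F N ⟨θ, ZrOfRecord₁₃ F N θ⟩)).SlotsNondegenerate₁₃ F N :=
  ⟨BalabanUVNodesN11GaussianCertificateRows.zhUnity_of_gaussCert _ (gaussPinH_ζ0 _), slotsNondegenerate₁₃_ccmwCR hθ⟩

/-- **THE `hθ` SLOT AT THE DOOR `θᴴ_c`** (admissibility reads the Stage-13 part only). [cite: Balaban1988Convergent, (2.6)–(2.8) pp.255–256; Balaban1989LargeFieldI, (0.4) p.176 (bookkeeping)] -/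
theorem admissible_door_ccmwCR (hθ : θ = theta13LiveOfNumerics F N
      ({ stage12NumericsOfThm1CCMW F.L j γ ε₀ B₃ B₃' a₀ a₁ with s2 := { sect2NumericsOfThm1C F.L with cR := c } } : Stage12Numerics) ε₂₉
      (zeta316OfRecord F N (stage12NumericsOfThm1CCMW F.L j γ ε₀ B₃ B₃' a₀ a₁).ν (stage12NumericsOfThm1CCMW F.L j γ ε₀ B₃ B₃' a₀ a₁).τ9.M
        (stage12NumericsOfThm1CCMW F.L j γ ε₀ B₃ B₃' a₀ a₁).A₁) (RzOfRecord F N) (ZtOfRecord F N)) (hc0 : 0 < c) (hγ0 : 0 < γ) (hγ1 : γ < 1) (hε : 0 < ε₀) (hε' : 0 < ε₂₉) (hB : 0 ≤ B₃) (hB' : 0 ≤ B₃')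
    (ha₀ : 0 < a₀) (ha₁ : 0 < a₁) : (Stage13HParams.ofHistoryBlind F N ⟨θ, ZrOfRecord₁₃ F N θ⟩).Admissible F N :=
  admissible_ccmwCR hθ hc0 hγ0 hγ1 hε hε' hB hB' ha₀ ha₁

/-- **THE `hθ` SLOT AT `θᴳ_c`** (the certificate keeps the Stage-13 part). [cite: Balaban1988Convergent, (2.6)–(2.8) pp.255–256; Balaban1989LargeFieldI, (0.4) p.176 (bookkeeping)] -/
theorem admissible_gaussPinH_door_ccmwCR (hθ : θ = theta13LiveOfNumerics F N
      ({ stage12NumericsOfThm1CCMW F.L j γ ε₀ B₃ B₃' a₀ a₁ with s2 := { sect2NumericsOfThm1C F.L with cR := c } } : Stage12Numerics) ε₂₉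
      (zeta316OfRecord F N (stage12NumericsOfThm1CCMW F.L j γ ε₀ B₃ B₃' a₀ a₁).ν (stage12NumericsOfThm1CCMW F.L j γ ε₀ B₃ B₃' a₀ a₁).τ9.M
        (stage12NumericsOfThm1CCMW F.L j γ ε₀ B₃ B₃' a₀ a₁).A₁) (RzOfRecord F N) (ZtOfRecord F N)) (hc0 : 0 < c) (hγ0 : 0 < γ) (hγ1 : γ < 1) (hε : 0 < ε₀) (hε' : 0 < ε₂₉) (hB : 0 ≤ B₃) (hB' : 0 ≤ B₃')
    (ha₀ : 0 < a₀) (ha₁ : 0 < a₁) : (gaussPinH (Stage13HParams.ofHistoryBlind F N ⟨θ, ZrOfRecord₁₃ F N θ⟩)).Admissible F N :=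
  admissible_ccmwCR hθ hc0 hγ0 hγ1 hε hε' hB hB' ha₀ ha₁


/-- **★ THE CHILDREN SLOTS OF THE DOOR THEOREM READ THE MEMBER EXACTLY AS `θ₁₅ᶜᶜᴹᵂ(j; γ)`** (`rfl` after `subst`): the Stage-3 part (`h06`: `Y9OfRecord N θ.toStage3Params …`, `h10`), the
block letter `θ.L` (`h08`: `PrintedUV3V N θ.L`), the background radius `θ.εbg`, NODE 00's bundle of record `WOfRecord₁₃ F N θ lamW P` (`h12`: `B15Leaf …`), the densities of record
`densOfRecord₁₃ F N θ P k` and the small-field factor `chiβOfRecord₁₃ … (gOfRecord₁₃ F N θ P) k` (`hUV`) — so every child theorem typed at `θ₁₅ᶜᶜᴹᵂ` for these slots re-reads at the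
member by `rfl`; only the door-bound slots (`hC ∕ hup`: the world bound to the member's datum) and the law slots (`h11 ∕ hR ∕ hUV`'s `SLaw₁₃CoPH` antecedents at `θᴴ_c`) are member-specific.
[cite: Balaban1988Convergent, (2.10) p.256, (3.16)–(3.22) pp.268–269; Balaban1989LargeFieldI, (0.2)–(0.4) p.176; Balaban1987RG1, (1.20)–(1.22) p.264 (bookkeeping)] -/
theorem childrenReads_ccmwCR (hθ : θ = theta13LiveOfNumerics F N
      ({ stage12NumericsOfThm1CCMW F.L j γ ε₀ B₃ B₃' a₀ a₁ with s2 := { sect2NumericsOfThm1C F.L with cR := c } } : Stage12Numerics) ε₂₉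
      (zeta316OfRecord F N (stage12NumericsOfThm1CCMW F.L j γ ε₀ B₃ B₃' a₀ a₁).ν (stage12NumericsOfThm1CCMW F.L j γ ε₀ B₃ B₃' a₀ a₁).τ9.M
        (stage12NumericsOfThm1CCMW F.L j γ ε₀ B₃ B₃' a₀ a₁).A₁) (RzOfRecord F N) (ZtOfRecord F N)) (lamW : ResidW F N) (P : B12.RunParams) (k : ℕ) :
    θ.toStage3Params = (theta13OfThm1CCMW F N j γ ε₀ ε₂₉ B₃ B₃' a₀ a₁).toStage3Params ∧ θ.L = (theta13OfThm1CCMW F N j γ ε₀ ε₂₉ B₃ B₃' a₀ a₁).L ∧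
      θ.εbg = (theta13OfThm1CCMW F N j γ ε₀ ε₂₉ B₃ B₃' a₀ a₁).εbg ∧
      WOfRecord₁₃ F N θ lamW P = WOfRecord₁₃ F N (theta13OfThm1CCMW F N j γ ε₀ ε₂₉ B₃ B₃' a₀ a₁) lamW P ∧
      densOfRecord₁₃ F N θ P k = densOfRecord₁₃ F N (theta13OfThm1CCMW F N j γ ε₀ ε₂₉ B₃ B₃' a₀ a₁) P k ∧
      chiβOfRecord₁₃ F N θ P.K (gOfRecord₁₃ F N θ P) k =
        chiβOfRecord₁₃ F N (theta13OfThm1CCMW F N j γ ε₀ ε₂₉ B₃ B₃' a₀ a₁) P.K (gOfRecord₁₃ F N (theta13OfThm1CCMW F N j γ ε₀ ε₂₉ B₃ B₃' a₀ a₁) P) k := by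
  subst hθ
  exact ⟨rfl, rfl, rfl, rfl, rfl, rfl⟩

end Slots

/-! ## §2  ★★★ K0⁷'s body at the member's door and at its Gaussian certificate, from Part 14 §0c's inputs; the ∃-body with `cR = c` -/

section Body

/-- **★★★ K0⁷'s BODY AT THE MEMBER's HISTORY-BLIND DOOR `θᴴ_c` FROM dag-n24-c PART 14 §0c's K0-SIDE INPUTS VERBATIM + `0 < c ≤ 8`**: `Provisos₁₃SepCoPH` (p620936 ★★★★) ∧ (`ZhUnity` ∧
`SlotsNondegenerate₁₃`) (§1, unconditional) ∧ `Admissible` (§1).  CONDITIONAL on the displayed sentences; nothing of Bałaban asserted.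
[cite: Balaban1985Variational, Thm 1 (8)–(9) p.279, (152) p.301, Prop. 8 p.304; Balaban1988Convergent, Thm 1 p.262, (1.11) p.248, (2.6)–(2.8) pp.255–256, (2.10) p.256, (3.16)–(3.23) pp.268–270; Balaban1987RG1, Thm 1 p.259, (0.20) p.256, (1.20)–(1.22) p.264; Balaban1989LargeFieldI, (0.2)–(0.4) p.176] -/
theorem k0Body_door_ccmwCR_of_gauge9TopStepR_of_betaBoxSignFree_allTorus (hθ : θ = theta13LiveOfNumerics F N
      ({ stage12NumericsOfThm1CCMW F.L j γ ε₀ B₃ B₃' a₀ a₁ with s2 := { sect2NumericsOfThm1C F.L with cR := c } } : Stage12Numerics) ε₂₉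
      (zeta316OfRecord F N (stage12NumericsOfThm1CCMW F.L j γ ε₀ B₃ B₃' a₀ a₁).ν (stage12NumericsOfThm1CCMW F.L j γ ε₀ B₃ B₃' a₀ a₁).τ9.M
        (stage12NumericsOfThm1CCMW F.L j γ ε₀ B₃ B₃' a₀ a₁).A₁) (RzOfRecord F N) (ZtOfRecord F N))
    (hc0 : 0 < c) (hc8 : c ≤ 8) (hγ0 : 0 < γ) (hγ : γ ≤ 1 / 2) (hε : 0 < ε₀) (hε' : 0 < ε₂₉) (hB : 0 ≤ B₃) (hB' : 0 ≤ B₃') (ha₀ : 0 < a₀) (ha₁ : 0 < a₁)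
    (h15 : VariationalThm1RegSepCoP7M F N B₃ a₀ a₁) (hc₁₅ : c₁₅ ≤ F.L ^ j)
    (h9 : Gauge9RegSepTopStepR F N (fun ν K Ω => suppDomOfRecord F ν K Ω) (F.L ^ j) c₁₅ B₃ B₃' a₀ a₁)
    {bl β' : ℝ} (hbox : BetaLowerH bl γ (betaOfRecord₁₃ F N (theta13OfThm1CCMW F N j γ ε₀ ε₂₉ B₃ B₃' a₀ a₁)))
    (hbox' : BetaUpperH β' γ (betaOfRecord₁₃ F N (theta13OfThm1CCMW F N j γ ε₀ ε₂₉ B₃ B₃' a₀ a₁))) (hl : -bl * γ ^ 2 ≤ 3) (hβ' : β' * γ ^ 2 ≤ 3 / 4) :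
    (Stage13HParams.ofHistoryBlind F N ⟨θ, ZrOfRecord₁₃ F N θ⟩).Provisos₁₃SepCoPH F N ∧
      ((Stage13HParams.ofHistoryBlind F N ⟨θ, ZrOfRecord₁₃ F N θ⟩).ZhUnity F N ∧ (Stage13HParams.ofHistoryBlind F N ⟨θ, ZrOfRecord₁₃ F N θ⟩).SlotsNondegenerate₁₃ F N) ∧
      (Stage13HParams.ofHistoryBlind F N ⟨θ, ZrOfRecord₁₃ F N θ⟩).Admissible F N :=
  ⟨provisos₁₃SepCoPH_door_ccmwCR_of_gauge9TopStepR_of_betaBoxSignFree_allTorus hθ hc0 hc8 hγ0 hγ hε hε' hB hB' ha₀ ha₁ h15 hc₁₅ h9 hbox hbox' hl hβ',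
    zhUnity_slotsNondegenerate₁₃_door_ccmwCR hθ, admissible_door_ccmwCR hθ hc0 hγ0 (hγ.trans_lt (by norm_num)) hε hε' hB hB' ha₀ ha₁⟩

/-- **★★★ K⁷∕K1⁸'s ANTECEDENT AT THE GAUSSIAN CERTIFICATE `θᴳ_c := gaussPinH θᴴ_c` FROM PART 14 §0c's INPUTS + `0 < c ≤ 8`** (dag-n11-w1 `antecedent_gaussPinH` on p620936's door; dag-n11-w6
X6 §1's three slots, now at the cR-lettered member).  CONDITIONAL; nothing of Bałaban asserted.
[cite: Balaban1985Variational, Thm 1 (8)–(9) p.279, (152) p.301; Balaban1988Convergent, Thm 1 p.262, (2.6)–(2.8) pp.255–256, (2.10) p.256, (2.21) p.258, (3.16)–(3.23) pp.268–270; Balaban1987RG1, Thm 1 p.259, §1 p.264; Balaban1989LargeFieldI, (0.2)–(0.4) p.176] -/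
theorem antecedent_gaussPinH_door_ccmwCR_of_gauge9TopStepR_of_betaBoxSignFree_allTorus (hθ : θ = theta13LiveOfNumerics F N
      ({ stage12NumericsOfThm1CCMW F.L j γ ε₀ B₃ B₃' a₀ a₁ with s2 := { sect2NumericsOfThm1C F.L with cR := c } } : Stage12Numerics) ε₂₉
      (zeta316OfRecord F N (stage12NumericsOfThm1CCMW F.L j γ ε₀ B₃ B₃' a₀ a₁).ν (stage12NumericsOfThm1CCMW F.L j γ ε₀ B₃ B₃' a₀ a₁).τ9.M
        (stage12NumericsOfThm1CCMW F.L j γ ε₀ B₃ B₃' a₀ a₁).A₁) (RzOfRecord F N) (ZtOfRecord F N))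
    (hc0 : 0 < c) (hc8 : c ≤ 8) (hγ0 : 0 < γ) (hγ : γ ≤ 1 / 2) (hε : 0 < ε₀) (hε' : 0 < ε₂₉) (hB : 0 ≤ B₃) (hB' : 0 ≤ B₃') (ha₀ : 0 < a₀) (ha₁ : 0 < a₁)
    (h15 : VariationalThm1RegSepCoP7M F N B₃ a₀ a₁) (hc₁₅ : c₁₅ ≤ F.L ^ j)
    (h9 : Gauge9RegSepTopStepR F N (fun ν K Ω => suppDomOfRecord F ν K Ω) (F.L ^ j) c₁₅ B₃ B₃' a₀ a₁)
    {bl β' : ℝ} (hbox : BetaLowerH bl γ (betaOfRecord₁₃ F N (theta13OfThm1CCMW F N j γ ε₀ ε₂₉ B₃ B₃' a₀ a₁)))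
    (hbox' : BetaUpperH β' γ (betaOfRecord₁₃ F N (theta13OfThm1CCMW F N j γ ε₀ ε₂₉ B₃ B₃' a₀ a₁))) (hl : -bl * γ ^ 2 ≤ 3) (hβ' : β' * γ ^ 2 ≤ 3 / 4) :
    (gaussPinH (Stage13HParams.ofHistoryBlind F N ⟨θ, ZrOfRecord₁₃ F N θ⟩)).Provisos₁₃SepCoPH F N ∧
      ((gaussPinH (Stage13HParams.ofHistoryBlind F N ⟨θ, ZrOfRecord₁₃ F N θ⟩)).ZhUnity F N ∧ (gaussPinH (Stage13HParams.ofHistoryBlind F N ⟨θ, ZrOfRecord₁₃ F N θ⟩)).SlotsNondegenerate₁₃ F N) ∧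
      (gaussPinH (Stage13HParams.ofHistoryBlind F N ⟨θ, ZrOfRecord₁₃ F N θ⟩)).Admissible F N :=
  antecedent_gaussPinH (provisos₁₃SepCoPH_door_ccmwCR_of_gauge9TopStepR_of_betaBoxSignFree_allTorus hθ hc0 hc8 hγ0 hγ hε hε' hB hB' ha₀ ha₁ h15 hc₁₅ h9 hbox hbox' hl hβ')
    (slotsNondegenerate₁₃_ccmwCR hθ) (admissible_ccmwCR hθ hc0 hγ0 (hγ.trans_lt (by norm_num)) hε hε' hB hB' ha₀ ha₁)

/-- **★★★★ K0⁷'s ∃-BODY FOR `F` WITNESSED BY A PARAMETER WITH `θ.s2.cR = c`, ANY `c ∈ (0, 8]`, FROM PART 14 §0c's K0-SIDE INPUTS** — at `N = 2` the body of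
`Record13SepCoPHInhabited F` ∕ K1⁸'s antecedent `Inhabited13 F`, with the extra conjunct recording the regularity letter of the witness.  The witness is the member's door `θᴴ_c` (its
Gaussian certificate `θᴳ_c` serves equally, previous theorem).  CONDITIONAL on (8), the (9)-step and the sign-free windowed β-box of `betaOfRecord₁₃ F N θ₁₅ᶜᶜᴹᵂ(j; γ)`; K0⁷ NOT closed.
[cite: Balaban1985Variational, Thm 1 (8)–(9) p.279, (152) p.301, Prop. 8 p.304; Balaban1988Convergent, Thm 1 p.262, (2.10) p.256 («O(L²)» — here any `c ≤ 8`), (3.16)–(3.23) pp.268–270; Balaban1987RG1, Thm 1 p.259, (1.20)–(1.22) p.264; Balaban1989LargeFieldI, (0.2)–(0.4) p.176] -/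
theorem exists_k0Body_cR_eq_of_gauge9TopStepR_of_betaBoxSignFree_allTorus (F : T4Family) (N : ℕ) [NeZero N] {j c₁₅ : ℕ} {γ c ε₀ ε₂₉ B₃ B₃' a₀ a₁ : ℝ}
    (hc0 : 0 < c) (hc8 : c ≤ 8) (hγ0 : 0 < γ) (hγ : γ ≤ 1 / 2) (hε : 0 < ε₀) (hε' : 0 < ε₂₉) (hB : 0 ≤ B₃) (hB' : 0 ≤ B₃') (ha₀ : 0 < a₀) (ha₁ : 0 < a₁)
    (h15 : VariationalThm1RegSepCoP7M F N B₃ a₀ a₁) (hc₁₅ : c₁₅ ≤ F.L ^ j)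
    (h9 : Gauge9RegSepTopStepR F N (fun ν K Ω => suppDomOfRecord F ν K Ω) (F.L ^ j) c₁₅ B₃ B₃' a₀ a₁)
    {bl β' : ℝ} (hbox : BetaLowerH bl γ (betaOfRecord₁₃ F N (theta13OfThm1CCMW F N j γ ε₀ ε₂₉ B₃ B₃' a₀ a₁)))
    (hbox' : BetaUpperH β' γ (betaOfRecord₁₃ F N (theta13OfThm1CCMW F N j γ ε₀ ε₂₉ B₃ B₃' a₀ a₁))) (hl : -bl * γ ^ 2 ≤ 3) (hβ' : β' * γ ^ 2 ≤ 3 / 4) :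
    ∃ θ' : Stage13HParams F N, θ'.Provisos₁₃SepCoPH F N ∧ (θ'.ZhUnity F N ∧ θ'.SlotsNondegenerate₁₃ F N) ∧ θ'.Admissible F N ∧ θ'.s2.cR = c :=
  ⟨Stage13HParams.ofHistoryBlind F N ⟨theta13LiveOfNumerics F N
      ({ stage12NumericsOfThm1CCMW F.L j γ ε₀ B₃ B₃' a₀ a₁ with s2 := { sect2NumericsOfThm1C F.L with cR := c } } : Stage12Numerics) ε₂₉
      (zeta316OfRecord F N (stage12NumericsOfThm1CCMW F.L j γ ε₀ B₃ B₃' a₀ a₁).ν (stage12NumericsOfThm1CCMW F.L j γ ε₀ B₃ B₃' a₀ a₁).τ9.M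
        (stage12NumericsOfThm1CCMW F.L j γ ε₀ B₃ B₃' a₀ a₁).A₁) (RzOfRecord F N) (ZtOfRecord F N), ZrOfRecord₁₃ F N (theta13LiveOfNumerics F N
      ({ stage12NumericsOfThm1CCMW F.L j γ ε₀ B₃ B₃' a₀ a₁ with s2 := { sect2NumericsOfThm1C F.L with cR := c } } : Stage12Numerics) ε₂₉
      (zeta316OfRecord F N (stage12NumericsOfThm1CCMW F.L j γ ε₀ B₃ B₃' a₀ a₁).ν (stage12NumericsOfThm1CCMW F.L j γ ε₀ B₃ B₃' a₀ a₁).τ9.M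
        (stage12NumericsOfThm1CCMW F.L j γ ε₀ B₃ B₃' a₀ a₁).A₁) (RzOfRecord F N) (ZtOfRecord F N))⟩,
    (k0Body_door_ccmwCR_of_gauge9TopStepR_of_betaBoxSignFree_allTorus rfl hc0 hc8 hγ0 hγ hε hε' hB hB' ha₀ ha₁ h15 hc₁₅ h9 hbox hbox' hl hβ').1,
    (k0Body_door_ccmwCR_of_gauge9TopStepR_of_betaBoxSignFree_allTorus rfl hc0 hc8 hγ0 hγ hε hε' hB hB' ha₀ ha₁ h15 hc₁₅ h9 hbox hbox' hl hβ').2.1,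
    (k0Body_door_ccmwCR_of_gauge9TopStepR_of_betaBoxSignFree_allTorus rfl hc0 hc8 hγ0 hγ hε hε' hB hB' ha₀ ha₁ h15 hc₁₅ h9 hbox hbox' hl hβ').2.2, rfl⟩

end Body

end Summit.QuantumFields.YangMills.Theorems.BalabanUVNodesN11K0BodyAtCRLetteredDoor

end
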